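/- COR-CM (cell pub-hodgecm2) — Δ2 BRIDGE, ORIENTATION AUDIT: what COEFFICIENT conjugation `F∞ = conj ⊗ id` does to the
dictionary's CM classes (input to DECISION #19 (A) «Track T», sub-lemma (T3′)), wall-breaker wb-1 gen 1
(prover-pub-hodgecm2-d2bridge-wb-1-g1-0), CONJUGATION-TRANSPORT seat.  THEOREMS ONLY; nothing landed is edited or restated;
no named fact, no notation, no `sorry`.  FRAMING: HC_CM is NOT proved; «Δ2 BRIDGE CLOSED» is NOT claimed. -/
import Summits.HodgeConjecture.CorCM.D2Bridge.OrientationT2BlockVanishing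
import Summits.HodgeConjecture.CorCM.D2Bridge.CmClassesHodgeType
import Summits.HodgeConjecture.CorCM.D2Bridge.OrientationReflexConj
import HarnessLib

/-!
# Δ2 bridge, orientation audit: coefficient conjugation swaps the Hodge type of the CM classes

`F∞ := conj ⊗ id` on `ℂ ⊗_ℚ H¹(P_Γ; ℚ)` (`Literature.AlgebraicGeometry.Motives.HodgeStructure.conj`, Deligne's real structure)
FIXES the complex variety `P_Γ`, every complex abelian variety `d.A` and every `ℂ`-morphism `f`, and conjugates only coefficients;
it swaps the Hodge pieces, `conj H^{p,q} = H^{q,p}` (`HodgeStructure.complexConj_piece`).  Consequences for two tower dictionaries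
`T := ofTower … PhiMu adm`, `T' := ofTower … PhiMu' adm'` sharing the adèlic side (same `H`, `block`, `res` definitionally):

* §1 `conj_mem_piece_zero_one_of_mem_span_cmClasses` — if the `adm`-records at `μ` have their eigencharacter IN their CM type
  (classes of type `(1,0)`, ✔ `cmClasses_subset_hodge_piece_one_zero`), then `F∞` carries `span (T.cmClasses Γ μ)` into `H^{0,1}(P_Γ)`.
* §2 `cmClasses_subset_zero_of_conj_image_eq` — hence the transport hypothesis «`T'.cmClasses Γ μ' ⊆ F∞ '' (T.cmClasses Γ μ)`» (a fortiori the identity (T3′)) between a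
  `(1,0)`-keyed generator set and another `(1,0)`-keyed one forces `T'.cmClasses Γ μ' ⊆ {0}`; with `T'.Thm418C` at a `PhiMu'`
  character `μ'` this makes `block μ' = ⊥` (`block_eq_bot_of_thm418C_of_conj_image_eq`, wb-9's separation).
* §3 AT THE LITERAL PIN (`L/ℚ` Galois): the port's `𝔇 = liuDictionaryPin … V I line` (`adm i = IsReflexOfTypeG ι₁ (typeOfLine (line i))`,
  firing at `PhiMuLine ι₁ (line i)`) and the RE-KEYED `𝔇′ := ofTower … (PhiMuLine ῑ₁ ∘ line) (IsReflexOfTypeG ῑ₁ ∘ typeOfLine ∘ line)`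
  (firing at `PhiMuLine ῑ₁ (line ī)`) are BOTH `(1,0)`-keyed where they fire (own-crow's `tau_mem_cmType_of_isReflexOfType` read at `ι₁`
  resp. at `ῑ₁`): **`block_rekey_eq_bot_of_thm418C_of_conj_image_eq`** — the transport identity (T3′) «`F∞ '' (𝔇.cmClasses Γ i) =
  𝔇′.cmClasses Γ ī`» together with `𝔇′.Thm418C` forces `𝔇′.block ī = ⊥` (`= 𝔇.block ī`).  So (T3′) is available only on vanishing
  primed blocks: coefficient conjugation transports the `ι₁`-keyed generators to `(0,1)`-classes, i.e. to the HYBRID admissibility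
  `(ῑ₁, Φ_i)` of `OrientationT2ConjAdm`, never to the primed `(ῑ₁, Φ_ī)`-keyed generators.  The hypothesis shape
  «`cmCl' (eL K) (eC μ) ⊆ eW K '' cmCl K μ`» is the `hcm` binder of wb-5's `thm418Combined_of_conjTransport` (p372848) read at
  `eW K := conj ⊗ id`; this file says where it can be inhabited.
Nothing here asserts that any `Thm418C` is inhabited.
-/

set_option autoImplicit false
noncomputable section

namespace Summit.HodgeConjecture.CorCM.D2Bridge

open HodgeCM HodgeCM.Model
open HodgeCM.Model.TowerCarrier
open HodgeCM.Literature.Theta HodgeCM.Literature.Theta.LiuAlbaneseModuleDatum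
open Literature.AlgebraicGeometry.HodgeTheory
open Literature.AlgebraicGeometry.Motives (HodgeStructure)
open Literature.NumberTheory.Automorphic.PicardCM
open Literature.NumberTheory.Transcendental (Arapura2012_Cor_15_4_6)

variable {L : CMField} {ι₁ : L →+* ℂ}

/-! ## §1 `F∞` carries a `(1,0)`-keyed generator span into `H^{0,1}` -/

section CoeffConj

variable (V : HermSpace3 L ι₁)
variable (Char : Type) (Adm : Char → Type) (Ω : (μ : Char) → Adm μ → Type)
    [∀ μ a, AddCommGroup (Ω μ a)] [∀ μ a, Module ℂ (Ω μ a)] [∀ μ a, Module (adelicAlgebra V) (Ω μ a)]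
    [∀ μ a, IsScalarTower ℂ (adelicAlgebra V) (Ω μ a)]
    (PhiMu PhiMu' : Char → Prop) (adm adm' : Char → LiuCMSide → Prop)

/-- `conj H^{p,q} ∋ conj x` for `x ∈ H^{q,p}`: coefficient conjugation swaps the Hodge pieces (Hodge symmetry).
[cite: VoisinHodgeI2002, §7.1.1] -/
theorem conj_mem_piece_swap {W : Type} [AddCommGroup W] [Module ℚ W] {n : ℤ} (H : HodgeStructure W n) (p q : ℤ)
    {x : TensorProduct ℚ ℂ W} (hx : x ∈ H.piece p q) : HodgeStructure.conj x ∈ H.piece q p := by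
  have h : x ∈ HodgeStructure.complexConj (H.piece q p) := by
    rw [HodgeStructure.complexConj_piece]; exact hx
  exact (HodgeStructure.mem_complexConj).1 h

/-- **`F∞ (span cmClasses) ⊆ H^{0,1}` for a `(1,0)`-keyed generator set.**  If the `adm`-admissible records at `μ` have their
eigencharacter IN their CM type, every element of `span_ℂ (T.cmClasses Γ μ)` is a `(1,0)`-class, so its coefficient conjugate is a
`(0,1)`-class. [cite: VoisinHodgeI2002, §7.1.1 Def. 7.4 and §7.3.2] -/
theorem conj_mem_piece_zero_one_of_mem_span_cmClasses (hHD : exists_isReal_hodgeModel) (hI : hodgePQ_independent_of_hodgeModel)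
    (h₁ : BallQuotientUniformised) (h₃ : CMAbelianVarietyRealised) (hA : Arapura2012_Cor_15_4_6) (μ : Char) (Γ : Level V)
    (hadm : ∀ d : LiuCMSide, adm μ d → d.τ ∈ d.ΦA.1)
    {x : (picardCMUniverse hHD hI h₁ h₃).CohC ((picardCMUniverse hHD hI h₁ h₃).pms L ι₁ V Γ) 1}
    (hx : x ∈ Submodule.span ℂ ((LiuDictionary.ofTower hHD hI h₁ h₃ hA V Char Adm Ω PhiMu adm).cmClasses Γ μ)) :
    HodgeStructure.conj x ∈ ((picardCMUniverse hHD hI h₁ h₃).hodge ((picardCMUniverse hHD hI h₁ h₃).pms L ι₁ V Γ) 1).piece 0 1 := by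
  have h10 : x ∈ ((picardCMUniverse hHD hI h₁ h₃).hodge ((picardCMUniverse hHD hI h₁ h₃).pms L ι₁ V Γ) 1).piece 1 0 := by
    refine Submodule.span_le.2 ?_ hx
    simpa using cmClasses_subset_hodge_piece_one_zero (LiuDictionary.ofTower hHD hI h₁ h₃ hA V Char Adm Ω PhiMu adm) Γ μ hadm
  exact conj_mem_piece_swap _ 1 0 h10

/-! ## §2 A transport identity between two `(1,0)`-keyed generator sets forces the target generators to vanish -/

/-- **(T3′)-shaped transport hypotheses live only on vanishing generators.**  If `T'.cmClasses Γ μ' ⊆ F∞ '' (T.cmClasses Γ μ)` with BOTH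
generator sets `(1,0)`-keyed (`adm`-records at `μ` and `adm'`-records at `μ'` have their eigencharacter IN their CM type), then
`T'.cmClasses Γ μ' ⊆ {0}` (`H^{1,0} ∩ H^{0,1} = 0`). [cite: VoisinHodgeI2002, §6.1.3 Cor. 6.14] -/
theorem cmClasses_subset_zero_of_conj_image_eq (hHD : exists_isReal_hodgeModel) (hI : hodgePQ_independent_of_hodgeModel)
    (h₁ : BallQuotientUniformised) (h₃ : CMAbelianVarietyRealised) (hA : Arapura2012_Cor_15_4_6) (μ μ' : Char) (Γ : Level V)
    (hadm : ∀ d : LiuCMSide, adm μ d → d.τ ∈ d.ΦA.1) (hadm' : ∀ d : LiuCMSide, adm' μ' d → d.τ ∈ d.ΦA.1)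
    (hT3 : (LiuDictionary.ofTower hHD hI h₁ h₃ hA V Char Adm Ω PhiMu' adm').cmClasses Γ μ' ⊆
      HodgeStructure.conj '' ((LiuDictionary.ofTower hHD hI h₁ h₃ hA V Char Adm Ω PhiMu adm).cmClasses Γ μ)) :
    (LiuDictionary.ofTower hHD hI h₁ h₃ hA V Char Adm Ω PhiMu' adm').cmClasses Γ μ' ⊆ {0} := by
  intro y hy
  -- `y` is a `(1,0)`-class (primed keying) …
  have h10 : y ∈ ((picardCMUniverse hHD hI h₁ h₃).hodge ((picardCMUniverse hHD hI h₁ h₃).pms L ι₁ V Γ) 1).piece 1 0 := by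
    simpa using cmClasses_subset_hodge_piece_one_zero (LiuDictionary.ofTower hHD hI h₁ h₃ hA V Char Adm Ω PhiMu' adm') Γ μ' hadm' hy
  -- … and the conjugate of a `(1,0)`-class (transport hypothesis), hence a `(0,1)`-class
  obtain ⟨x, hx, rfl⟩ := hT3 hy
  have h01 := conj_mem_piece_zero_one_of_mem_span_cmClasses V Char Adm Ω PhiMu adm hHD hI h₁ h₃ hA μ Γ hadm
    (Submodule.subset_span hx)
  have hdisj := disjoint_hodgePiece_one_zero hHD hI h₁ h₃ (V := V) Γ
  exact (Submodule.disjoint_def.1 hdisj) _ h10 h01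

/-- **… and then `Thm418C` of the target dictionary empties its block.**  Under the same hypotheses plus `T'.Thm418C` at a `PhiMu'`
character `μ'`: `block μ' = ⊥` (every `K`-fixed block vector restricts into `span {0} = 0` below the threshold; wb-9's separation).
[cite: VoisinHodgeI2002, §6.1.3 Cor. 6.14] -/
theorem block_eq_bot_of_thm418C_of_conj_image_eq (hHD : exists_isReal_hodgeModel) (hI : hodgePQ_independent_of_hodgeModel)
    (h₁ : BallQuotientUniformised) (h₃ : CMAbelianVarietyRealised) (hA : Arapura2012_Cor_15_4_6) (μ μ' : Char)
    (hadm : ∀ d : LiuCMSide, adm μ d → d.τ ∈ d.ΦA.1) (hadm' : ∀ d : LiuCMSide, adm' μ' d → d.τ ∈ d.ΦA.1)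
    (hT3 : ∀ Γ : Level V, (LiuDictionary.ofTower hHD hI h₁ h₃ hA V Char Adm Ω PhiMu' adm').cmClasses Γ μ' ⊆
      HodgeStructure.conj '' ((LiuDictionary.ofTower hHD hI h₁ h₃ hA V Char Adm Ω PhiMu adm).cmClasses Γ μ))
    (h418' : (LiuDictionary.ofTower hHD hI h₁ h₃ hA V Char Adm Ω PhiMu' adm').Thm418C) (hΦ' : PhiMu' μ') :
    (LiuDictionary.ofTower hHD hI h₁ h₃ hA V Char Adm Ω PhiMu' adm').block μ' = ⊥ := by
  refine block_ofTower_eq_bot_of_res_eq_zero V Char Adm Ω PhiMu' adm' hHD hI h₁ h₃ hA μ' ?_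
  obtain ⟨K₀, hK₀⟩ := h418' μ' hΦ'
  refine ⟨K₀, fun Γ hΓ x hx hfix => ?_⟩
  have hspan := hK₀ Γ hΓ x hx hfix
  have hle : Submodule.span ℂ ((LiuDictionary.ofTower hHD hI h₁ h₃ hA V Char Adm Ω PhiMu' adm').cmClasses Γ μ') ≤ ⊥ := by
    rw [Submodule.span_le]
    intro y hy
    have h0 := cmClasses_subset_zero_of_conj_image_eq V Char Adm Ω PhiMu PhiMu' adm adm' hHD hI h₁ h₃ hA μ μ' Γ hadm hadm'
      (hT3 Γ) hy
    rw [Set.mem_singleton_iff] at h0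
    simp [h0]
  exact (Submodule.mem_bot ℂ).1 (hle hspan)

end CoeffConj

/-! ## §3 AT THE LITERAL PIN: the port's `𝔇` (keyed `ι₁`) and the re-keyed `𝔇′` (keyed `ῑ₁ = conj ∘ ι₁`) are both `(1,0)`-keyed
where they fire, so the transport identity (T3′) between them empties the primed block -/

section Pin

variable (V : HermSpace3 L ι₁) (I : Type) (line : I → SplitLineE V)

/-- **(T3′) + `𝔇′.Thm418C` ⇒ the primed block vanishes.**  `L/ℚ` Galois.  Let `𝔇 := liuDictionaryPin … V I line` (the port:
`adm i d = d.IsReflexOfTypeG ι₁ (typeOfLine (line i))`) and `𝔇′` the dictionary RE-KEYED at `ῑ₁` (both `PhiMu` and `adm`: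
`PhiMuLine ῑ₁ (line ī)`, `d.IsReflexOfTypeG ῑ₁ (typeOfLine (line ī))`).  At a `PhiMu` line `i` the port's generators are `(1,0)`-classes,
at a `PhiMu′` line `ī` the primed generators are `(1,0)`-classes too (own-crow's `tau_mem_cmType_of_isReflexOfType`, read at `ι₁` resp.
at `ῑ₁`).  Hence the coefficient-conjugation transport hypothesis «`𝔇′.cmClasses Γ ī ⊆ F∞ '' (𝔇.cmClasses Γ i)` for all `Γ`» (wb-5's `hcm` at
`eW := conj ⊗ id`; a fortiori the identity (T3′)) together with
`𝔇′.Thm418C` forces `𝔇′.block ī = ⊥` (which is `𝔇.block ī`, definitionally).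
[cite: Shimura1998, §8.3 Prop. 28] [cite: VoisinHodgeI2002, §6.1.3 Cor. 6.14] -/
theorem block_rekey_eq_bot_of_thm418C_of_conj_image_eq [IsGalois ℚ L]
    (hHD : exists_isReal_hodgeModel) (hI : hodgePQ_independent_of_hodgeModel)
    (h₁ : BallQuotientUniformised) (h₃ : CMAbelianVarietyRealised) (hA : Arapura2012_Cor_15_4_6) (i ī : I)
    (hΦ : SplitLine.PhiMuLine ι₁ (line i)) (hΦ' : SplitLine.PhiMuLine ((starRingEnd ℂ).comp ι₁) (line ī))
    (hT3 : ∀ Γ : Level V,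
      (LiuDictionary.ofTower hHD hI h₁ h₃ hA V I (fun i => {χ : (line i).CharW // (line i).IsAutChar χ})
        (fun i a => (line i).Ω (ιVE V) a.1) (fun i => SplitLine.PhiMuLine ((starRingEnd ℂ).comp ι₁) (line i))
        (fun i dd => dd.IsReflexOfTypeG ((starRingEnd ℂ).comp ι₁) (SplitLine.typeOfLine (line i)))).cmClasses Γ ī ⊆
      HodgeStructure.conj '' ((liuDictionaryPin hHD hI h₁ h₃ hA V I line).cmClasses Γ i))
    (h418' : (LiuDictionary.ofTower hHD hI h₁ h₃ hA V I (fun i => {χ : (line i).CharW // (line i).IsAutChar χ})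
        (fun i a => (line i).Ω (ιVE V) a.1) (fun i => SplitLine.PhiMuLine ((starRingEnd ℂ).comp ι₁) (line i))
        (fun i dd => dd.IsReflexOfTypeG ((starRingEnd ℂ).comp ι₁) (SplitLine.typeOfLine (line i)))).Thm418C) :
    (LiuDictionary.ofTower hHD hI h₁ h₃ hA V I (fun i => {χ : (line i).CharW // (line i).IsAutChar χ})
        (fun i a => (line i).Ω (ιVE V) a.1) (fun i => SplitLine.PhiMuLine ((starRingEnd ℂ).comp ι₁) (line i))
        (fun i dd => dd.IsReflexOfTypeG ((starRingEnd ℂ).comp ι₁) (SplitLine.typeOfLine (line i)))).block ī = ⊥ :=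
  block_eq_bot_of_thm418C_of_conj_image_eq V I _ _ _ _ _ _ hHD hI h₁ h₃ hA i ī
    (fun d hd => tau_mem_cmType_of_isReflexOfType ι₁ d _ (hd inferInstance) hΦ)
    (fun d hd => tau_mem_cmType_of_isReflexOfType ((starRingEnd ℂ).comp ι₁) d _ (hd inferInstance) hΦ')
    hT3 h418' hΦ'

/-- **`F∞` of the port's generators at a `PhiMu` line are `(0,1)`-classes** — so the class set they CAN coincide with is a
`(0,1)`-keyed one (the hybrid `(ῑ₁, Φ_i)`-admissibility of `OrientationT2ConjAdm`), not the primed `(ῑ₁, Φ_ī)`-keyed one.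
[cite: Shimura1998, §8.3 Prop. 28] [cite: VoisinHodgeI2002, §7.1.1] -/
theorem conj_mem_piece_zero_one_of_mem_span_cmClasses_pin [IsGalois ℚ L]
    (hHD : exists_isReal_hodgeModel) (hI : hodgePQ_independent_of_hodgeModel)
    (h₁ : BallQuotientUniformised) (h₃ : CMAbelianVarietyRealised) (hA : Arapura2012_Cor_15_4_6) (i : I) (Γ : Level V)
    (hΦ : SplitLine.PhiMuLine ι₁ (line i))
    {x : (picardCMUniverse hHD hI h₁ h₃).CohC ((picardCMUniverse hHD hI h₁ h₃).pms L ι₁ V Γ) 1}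
    (hx : x ∈ Submodule.span ℂ ((liuDictionaryPin hHD hI h₁ h₃ hA V I line).cmClasses Γ i)) :
    HodgeStructure.conj x ∈ ((picardCMUniverse hHD hI h₁ h₃).hodge ((picardCMUniverse hHD hI h₁ h₃).pms L ι₁ V Γ) 1).piece 0 1 :=
  conj_mem_piece_zero_one_of_mem_span_cmClasses V I _ _ _ _ hHD hI h₁ h₃ hA i Γ
    (fun d hd => tau_mem_cmType_of_isReflexOfType ι₁ d _ (hd inferInstance) hΦ) hx

end Pin

/-! ## §4 The port's `h418` and the re-keyed `H418′` TOGETHER WITH Track T's own frame (T1) `F, hF, hres` + the one-sided block law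
force the `PhiMu` blocks to vanish — no class-transport hypothesis (T3′) at all -/

section TwoKeyings

variable (V : HermSpace3 L ι₁)
variable (Char : Type) (Adm : Char → Type) (Ω : (μ : Char) → Adm μ → Type)
    [∀ μ a, AddCommGroup (Ω μ a)] [∀ μ a, Module ℂ (Ω μ a)] [∀ μ a, Module (adelicAlgebra V) (Ω μ a)]
    [∀ μ a, IsScalarTower ℂ (adelicAlgebra V) (Ω μ a)]
    (PhiMu PhiMu' : Char → Prop) (adm adm' : Char → LiuCMSide → Prop)

/-- **Two `(1,0)`-keyed readings related by an antilinear frame contradict each other on non-zero blocks.**  Let `T := ofTower … PhiMu adm`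
and `T' := ofTower … PhiMu' adm'` be `(1,0)`-keyed at `μ` resp. `μ'` (admissible records have their eigencharacter IN their CM type), and let
`F` be a conjugate-linear endomorphism of the tower, Hecke-equivariant, carrying `block μ` into `block μ'`, and compatible with the
identity-component restrictions up to `conj ⊗ id` — the binders `F, hF, hblock, hres` of wb-5's `thm418C_ofTower_of_conj` (PROPOSAL T,
sub-lemmas (T1)+(T4)).  Then `T.Thm418C` at `μ` and `T'.Thm418C` at `μ'` together force `T.block μ = ⊥`: for a `K`-fixed block vector
`x`, `res x` is a `(1,0)`-class, `res (F x) = conj (res x)` is then a `(0,1)`-class AND (primed reading) a `(1,0)`-class, so `res x = 0`;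
the tower separates (wb-9). [cite: VoisinHodgeI2002, §6.1.3 Cor. 6.14] [cite: DeligneHodgeII1971, 2.1.4] -/
theorem block_eq_bot_of_thm418C_of_thm418C_of_conjFrame (hHD : exists_isReal_hodgeModel) (hI : hodgePQ_independent_of_hodgeModel)
    (h₁ : BallQuotientUniformised) (h₃ : CMAbelianVarietyRealised) (hA : Arapura2012_Cor_15_4_6) (μ μ' : Char)
    (hadm : ∀ d : LiuCMSide, adm μ d → d.τ ∈ d.ΦA.1) (hadm' : ∀ d : LiuCMSide, adm' μ' d → d.τ ∈ d.ΦA.1)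
    (F : Tower hHD hI (ballQuotientUniformisedDatum_of h₁) h₃ hA V →ₗ⋆[ℂ]
      Tower hHD hI (ballQuotientUniformisedDatum_of h₁) h₃ hA V)
    (hF : ∀ (g : V.adelicFin) (x : Tower hHD hI (ballQuotientUniformisedDatum_of h₁) h₃ hA V),
      F (act hHD hI (ballQuotientUniformisedDatum_of h₁) h₃ hA g x) =
        act hHD hI (ballQuotientUniformisedDatum_of h₁) h₃ hA g (F x))
    (hblock : ((LiuDictionary.ofTower hHD hI h₁ h₃ hA V Char Adm Ω PhiMu adm).block μ).map F ≤
      (LiuDictionary.ofTower hHD hI h₁ h₃ hA V Char Adm Ω PhiMu' adm').block μ')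
    (hres : ∀ (K : Level V) (x : Tower hHD hI (ballQuotientUniformisedDatum_of h₁) h₃ hA V),
      resTotal hHD hI (ballQuotientUniformisedDatum_of h₁) h₃ hA K (F x) =
        HodgeStructure.conj (resTotal hHD hI (ballQuotientUniformisedDatum_of h₁) h₃ hA K x))
    (h418 : (LiuDictionary.ofTower hHD hI h₁ h₃ hA V Char Adm Ω PhiMu adm).Thm418C) (hΦ : PhiMu μ)
    (h418' : (LiuDictionary.ofTower hHD hI h₁ h₃ hA V Char Adm Ω PhiMu' adm').Thm418C) (hΦ' : PhiMu' μ') :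
    (LiuDictionary.ofTower hHD hI h₁ h₃ hA V Char Adm Ω PhiMu adm).block μ = ⊥ := by
  refine block_ofTower_eq_bot_of_res_eq_zero V Char Adm Ω PhiMu adm hHD hI h₁ h₃ hA μ ?_
  obtain ⟨K₀, hK₀⟩ := h418 μ hΦ
  obtain ⟨K₀', hK₀'⟩ := h418' μ' hΦ'
  refine ⟨K₀ ⊓ K₀', fun Γ hΓ x hx hfix => ?_⟩
  -- (a) the live reading: `res Γ x` is a `(1,0)`-class, so its coefficient conjugate is a `(0,1)`-class
  have h01 : HodgeStructure.conj ((LiuDictionary.ofTower hHD hI h₁ h₃ hA V Char Adm Ω PhiMu adm).res Γ x) ∈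
      ((picardCMUniverse hHD hI h₁ h₃).hodge ((picardCMUniverse hHD hI h₁ h₃).pms L ι₁ V Γ) 1).piece 0 1 :=
    conj_mem_piece_zero_one_of_mem_span_cmClasses V Char Adm Ω PhiMu adm hHD hI h₁ h₃ hA μ Γ hadm
      (hK₀ Γ (hΓ.trans inf_le_left) x hx hfix)
  -- (b) `F x` is a `Γ.K`-fixed vector of the primed block
  have hx' : F x ∈ (LiuDictionary.ofTower hHD hI h₁ h₃ hA V Char Adm Ω PhiMu' adm').block μ' := hblock ⟨x, hx, rfl⟩
  have hfix' : F x ∈ fixedBy Γ.K (LiuDictionary.ofTower hHD hI h₁ h₃ hA V Char Adm Ω PhiMu' adm').H := by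
    refine (mem_fixedBy Γ.K _).2 fun k hk => ?_
    have hk' := (mem_fixedBy Γ.K _).1 hfix k hk
    change MonoidAlgebra.of ℂ (↥V.adelicFin) k • F x = F x
    change MonoidAlgebra.of ℂ (↥V.adelicFin) k • x = x at hk'
    rw [of_smul_eq_act] at hk' ⊢
    rw [← hF, hk']
  -- (c) the primed reading: `res Γ (F x) = conj (res Γ x)` is a `(1,0)`-class
  have h10 : HodgeStructure.conj ((LiuDictionary.ofTower hHD hI h₁ h₃ hA V Char Adm Ω PhiMu adm).res Γ x) ∈
      ((picardCMUniverse hHD hI h₁ h₃).hodge ((picardCMUniverse hHD hI h₁ h₃).pms L ι₁ V Γ) 1).piece 1 0 := by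
    have h := hK₀' Γ (hΓ.trans inf_le_right) (F x) hx' hfix'
    have hsub : (LiuDictionary.ofTower hHD hI h₁ h₃ hA V Char Adm Ω PhiMu' adm').cmClasses Γ μ' ⊆
        ((picardCMUniverse hHD hI h₁ h₃).hodge ((picardCMUniverse hHD hI h₁ h₃).pms L ι₁ V Γ) 1).piece 1 0 := by
      simpa using cmClasses_subset_hodge_piece_one_zero
        (LiuDictionary.ofTower hHD hI h₁ h₃ hA V Char Adm Ω PhiMu' adm') Γ μ' hadm'
    have h' := Submodule.span_le.2 hsub h
    have e : (LiuDictionary.ofTower hHD hI h₁ h₃ hA V Char Adm Ω PhiMu' adm').res Γ (F x) =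
        HodgeStructure.conj ((LiuDictionary.ofTower hHD hI h₁ h₃ hA V Char Adm Ω PhiMu adm).res Γ x) := hres Γ x
    rw [e] at h'
    exact h'
  -- (d) `H^{1,0} ∩ H^{0,1} = 0`, and `conj` is an involution
  have hdisj := disjoint_hodgePiece_one_zero hHD hI h₁ h₃ (V := V) Γ
  have h0 : HodgeStructure.conj ((LiuDictionary.ofTower hHD hI h₁ h₃ hA V Char Adm Ω PhiMu adm).res Γ x) = 0 :=
    (Submodule.disjoint_def.1 hdisj) _ h10 h01
  have := congrArg HodgeStructure.conj h0
  rwa [HodgeStructure.conj_conj, map_zero] at this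

end TwoKeyings

section TwoKeyingsPin

variable (V : HermSpace3 L ι₁) (I : Type) (line : I → SplitLineE V)

/-- **AT THE LITERAL PIN: the port's `h418` (keyed `ι₁`) and the re-keyed `H418′` (keyed `ῑ₁`) contradict each other on every non-zero
`PhiMu` block related to a `PhiMu′` block by Track T's frame.**  `L/ℚ` Galois.  With `𝔇 := liuDictionaryPin … V I line` and
`𝔇′ := ofTower … (PhiMuLine ῑ₁ ∘ line) (IsReflexOfTypeG ῑ₁ ∘ typeOfLine ∘ line)`: a conjugate-linear Hecke-equivariant `F` on the tower with
`F (𝔇.block i) ≤ 𝔇′.block ī` and `resTotal K (F x) = conj (resTotal K x)` ((T1)+(T4) of PROPOSAL T), plus `𝔇.Thm418C` and `𝔇′.Thm418C`,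
give `𝔇.block i = ⊥` at every line `i` with `PhiMuLine ι₁ (line i)` and `PhiMuLine ῑ₁ (line ī)`.  So `Rekey.H418 → live h418` transported
along such a frame is an implication between statements about EMPTY blocks. [cite: Shimura1998, §8.3 Prop. 28] [cite: VoisinHodgeI2002, §6.1.3 Cor. 6.14] -/
theorem block_pin_eq_bot_of_thm418C_of_thm418C_rekey_of_conjFrame [IsGalois ℚ L]
    (hHD : exists_isReal_hodgeModel) (hI : hodgePQ_independent_of_hodgeModel)
    (h₁ : BallQuotientUniformised) (h₃ : CMAbelianVarietyRealised) (hA : Arapura2012_Cor_15_4_6) (i ī : I)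
    (hΦ : SplitLine.PhiMuLine ι₁ (line i)) (hΦ' : SplitLine.PhiMuLine ((starRingEnd ℂ).comp ι₁) (line ī))
    (F : Tower hHD hI (ballQuotientUniformisedDatum_of h₁) h₃ hA V →ₗ⋆[ℂ]
      Tower hHD hI (ballQuotientUniformisedDatum_of h₁) h₃ hA V)
    (hF : ∀ (g : V.adelicFin) (x : Tower hHD hI (ballQuotientUniformisedDatum_of h₁) h₃ hA V),
      F (act hHD hI (ballQuotientUniformisedDatum_of h₁) h₃ hA g x) =
        act hHD hI (ballQuotientUniformisedDatum_of h₁) h₃ hA g (F x))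
    (hblock : ((liuDictionaryPin hHD hI h₁ h₃ hA V I line).block i).map F ≤
      (LiuDictionary.ofTower hHD hI h₁ h₃ hA V I (fun i => {χ : (line i).CharW // (line i).IsAutChar χ})
        (fun i a => (line i).Ω (ιVE V) a.1) (fun i => SplitLine.PhiMuLine ((starRingEnd ℂ).comp ι₁) (line i))
        (fun i dd => dd.IsReflexOfTypeG ((starRingEnd ℂ).comp ι₁) (SplitLine.typeOfLine (line i)))).block ī)
    (hres : ∀ (K : Level V) (x : Tower hHD hI (ballQuotientUniformisedDatum_of h₁) h₃ hA V),
      resTotal hHD hI (ballQuotientUniformisedDatum_of h₁) h₃ hA K (F x) =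
        HodgeStructure.conj (resTotal hHD hI (ballQuotientUniformisedDatum_of h₁) h₃ hA K x))
    (h418 : (liuDictionaryPin hHD hI h₁ h₃ hA V I line).Thm418C)
    (h418' : (LiuDictionary.ofTower hHD hI h₁ h₃ hA V I (fun i => {χ : (line i).CharW // (line i).IsAutChar χ})
        (fun i a => (line i).Ω (ιVE V) a.1) (fun i => SplitLine.PhiMuLine ((starRingEnd ℂ).comp ι₁) (line i))
        (fun i dd => dd.IsReflexOfTypeG ((starRingEnd ℂ).comp ι₁) (SplitLine.typeOfLine (line i)))).Thm418C) :
    (liuDictionaryPin hHD hI h₁ h₃ hA V I line).block i = ⊥ :=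
  block_eq_bot_of_thm418C_of_thm418C_of_conjFrame V I _ _ _ _ _ _ hHD hI h₁ h₃ hA i ī
    (fun d hd => tau_mem_cmType_of_isReflexOfType ι₁ d _ (hd inferInstance) hΦ)
    (fun d hd => tau_mem_cmType_of_isReflexOfType ((starRingEnd ℂ).comp ι₁) d _ (hd inferInstance) hΦ')
    F hF hblock hres h418 hΦ h418' hΦ'

end TwoKeyingsPin

end Summit.HodgeConjecture.CorCM.D2Bridge

end
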